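import Summits.QuantumFields.YangMills.Theorems.BalabanUVNodesK0Stub1DoubleBarFibreDictionary
import Summits.QuantumFields.YangMills.Theorems.BalabanUVNodesK0Stub1DoubleBarFramesSU
import Summits.QuantumFields.YangMills.Theorems.BalabanUVNodesN07ChartLogReality
import Literature.MathematicalPhysics.QuantumFieldTheory.Balaban1983to89.T3PrintedRegularOrbits
import Literature.MathematicalPhysics.QuantumFieldTheory.Balaban1983to89.Node00.DatumAvLayer
import HarnessLib

/-!
# K0⁷ STUB 1 (`stub_prop8StepCoP13`), sub-target S4a — **THE ♭ → (0.4) FIBRE DICTIONARY AT THE K0 CARRIER**: a charted competitor with the DOUBLE-BAR data of the charted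
# base point has an `SU(N)` GAUGE COPY IN NODE 00's MULTI-LEVEL (0.4) FIBRE — the record's guarded `SU(N)` averages `avOfRecord = blockAvg expMeanLogSU` of the copy and of the
# base point agree at EVERY [B6] (2.3) index bond of EVERY level (file 2 of this seat's g7 ♭-road socket-producer bricks; file 1 = `…K0Stub1DoubleBarFibreDictionary`, file 3 = `…K0Stub1DoubleBarFramesSU`)

Cell `pub-ymgap`, width seat `pub-ymgap-k0-s1-w1` g7 (CLAIM-2).  `--kind proof --supports stmt-QuantumFields-20541 --as helper`; count-neutral.  [15] = [Balaban1985Variational];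
[B7AVG] = [Balaban1985Averaging]; [B6] = [Balaban1984PropagatorsII]; [I] = [Balaban1987RG1]; [III] = [Balaban1988Convergent].

WHY.  File 1 (`exists_fineGauge_pred_family`) produces, for fields with equal double-bar data on the index bonds of a nested family with the collar, ONE fine gauge map `g : T_η → 𝔸ˣ`
(values in any multiplicative predicate the block frames satisfy) carrying the competitor onto the SINGLE-bar data of the base point at every index bond of every level — on the complex
side (pillar P3's unguarded `emlIterU` of `M_N(ℂ)ˣ`-fields).  NODE 00's record is critical on the fibre of its OWN averaging `avOfRecord F N K = blockAvg expMeanLogSU` (the GUARDED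
`SU(N)` (0.4) average, `Node00.IsCritOnFibre` ∕ `B15.AgreeOn (avgFamily …)`).  This file crosses over: (i) the predicate «its matrix is an `SU(N)` matrix» is multiplicative and
inverse-closed on the units of `M_N(ℂ)` (§1), so `g` lifts to `h : T_η → SU(N)`; (ii) the guarded average is gauge-COVARIANT EXACTLY (`Setup.Averaging.covariant`, iterated:
`T4Continuum.iter_gaugeAct`, block-centre tower `transfUp h j = h ∘ embIter j`); (iii) on the weighted ball with the dictionary budgets the charted fields' unguarded complex averages ARE
the guarded `SU(N)` averages at every index bond (dag-n07-w2 g3 ✓`N07ChartLogReality.coe_emlIterU_expCfg_eq_iter`); (iv) `SU(N) → M_N(ℂ)ˣ` is injective.  Hence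
`Ū^{(j)}_{(0.4)}(U^{h})(c) = Ū^{(j)}_{(0.4)}(U₁)(c)` at every index bond: the competitor's `SU(N)` gauge copy lies IN the record's multi-level fibre through `U₁`.  With the family form's
uniform-choice clause (each `h t x` is `1` or ONE fixed frame quotient along the family) this is what the ♭-road socket `h127rec` needs at the configuration level: the charted curve
`t ↦ e^{iη·chart♭(A′₁ + tδ)}`, gauge-corrected by `h t`, runs inside the fibre on which the record is critical, and `𝔄` is gauge-blind.

WHAT IS PROVED (sorry-free; no definition; axioms standard; generic `P : Params`, `N ≥ 1`).
* §0 `dbarIterU_eq_of_chartLogFlat_eq` — equal `Q♭ = chartLogFlat` values at an index (both double-bar bond variables within `1` of the identity) ⇒ equal double-bar bond variables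
  (`exp ∘ log = id`, ✓`MatrixLog.exp_mlog`): the (49)♭-charted competitors' form of the `hidx` hypothesis.
* §1 bookkeeping: `transfUp_eq_comp_embIter` (`transfUp h j y = h (embIter j y)`), `unitsField_gaugeAct_level` (every level; `B10Eq68….unitsField_gaugeAct` is level `0`),
  `eq_of_unitsField_toUField_eq`, `suPred_one ∕ _mul` (the `SU(N)` predicate on `M_N(ℂ)ˣ`; inverse-closure is file 3's `suN_pred_inv`).
* §2 ★★★ `exists_suGauge_family_iter_eq` (FAMILY form, uniform-choice clause + the fibre equalities for the guarded averages `Averaging.iter (fun _ => blockAvg expMeanLogSU)`) and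
  ★★★ `exists_suGauge_iter_eq` (one competitor) — displayed: the dictionary budgets `12800ℓ²LR ≤ 1`, `60ℓ²LR < δ_N` + weighted ball (n07-w2's), equal double-bar data on `BondIdx D`,
  and the block frames of the towers in `SU(N)` on an `emb`-closed family of small-readable blocks `Sm ⊇ Ω` (`hvf`, `hvf₁`; abstract `Sm`).
* §3 ★★★ `exists_suGauge_family_avgFamily_eq` — §2 at NODE 00's record objects (`F : T4Family`, `P = F.P K`): `avgFamily (avOfRecord F N K) ((U t)^{h t}) j c =
  avgFamily (avOfRecord F N K) U₁ j c` at every index bond of every level `j ≤ k` (`avOfRecord_apply` is `rfl`) — the letters of `Node00.IsCritOnFibre` ∕ `AgreeOn`.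
(§4–§6 — `hvf` DISCHARGED at `Sm := Ω` on the weighted ball and the CLOSED editions — are the companion file `…K0Stub1DoubleBarFibreAtRecordClosed`, over file 3.)

HONEST SCOPE.  Bookkeeping over file 1, n07-w2 g3's dictionary and `Setup`'s covariance field; the `SU(N)`-valuedness of the block frames on an abstract small-readable family (`Sm`, `hvf`,
`hvf₁`), the budgets, the weighted ball, the charted readings and the equal double-bar data are DISPLAYED here (the companion file discharges `Sm`∕`hvf`); NO estimate of Bałaban's
proved or asserted; NO derivative (the differentiability of `t ↦ h t` along a charted curve and the criticality transfer are
the next bricks); the SOCKET `h127rec` is NOT produced here; `stub_prop8StepCoP13` ∕ K0⁷ NOT closed; N07 NOT discharged; counts unmoved (28∕28 · 5∕27); one finite 𝕋⁴ programme at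
fixed ε — R4 closes the conditional finite-𝕋⁴ rung `BalabanLadder.UV` only, never the summit; the YM mass gap (Clay) is NOT proved by any of this; nothing continuum ∕ ℝ⁴ ∕ OS.
No `sorry`, no `def`, no `instance`, no `notation`.

References: [B7AVG] T. Bałaban, CMP **98** (1985) 17–51 ((8), (11) p.19, (19) p.21, (89) p.31, (92) p.31, (97)–(100) p.32, (110) p.34); [B6] CMP **96** (1984) 223–250 ((2.1)–(2.4)
p.224); [15] CMP **102** (1985) 277–309 ((5)–(6) p.278, (20) p.281, (44)–(49) p.285, (152) p.301, (156) p.302); [I] CMP **109** (1987) 249–301 ((0.1) p.251, (0.4), (0.11) p.253);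
[III] CMP **119** (1988) 243–285 ((2.10)–(2.12) p.256).
-/

set_option autoImplicit false

noncomputable section

namespace Summit.QuantumFields.YangMills.Theorems.K0Stub1DoubleBarFibreAtRecord

open scoped BigOperators Matrix.Norms.L2Operator
open Literature.MathematicalPhysics.QuantumFieldTheory.Balaban1983to89
open T4Continuum BlockAveraging ExpMeanLog
open B10Eq27TorusAxialLog (gaugeActT gaugeActT_apply unitsField val_unitsField toUField suIncl val_suIncl)
open B5Eq118OneStroke (iterBlockOf)
open B15DeterminingSets (embIter)
open B6SectADomainsV1 (Domains)
open B6SectAOperatorsV1 (BondIdx)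
open Literature.MathematicalPhysics.QuantumFieldTheory.Balaban1983to89.T3PrintedRegularOrbits (toUField_gaugeAct)
open Summit.QuantumFields.YangMills.Theorems.Prop8Chart (expCfg emlIterU)
open Summit.QuantumFields.YangMills.Theorems.Prop8ChartDoubleBar (vframeU dbarIterU exists_accFrames_dbarIterU chartLogFlat chartLogFlat_apply)
open MatrixLog (mlog exp_mlog)
open Node00 (avOfRecord)
open B15DeterminingSets (avgFamily)
open Summit.QuantumFields.YangMills.Theorems.K0FlatCubeOpsTextP (IsLevWeight)
open Summit.QuantumFields.YangMills.BalabanUVNodes.N07ChartLogReality (coe_emlIterU_expCfg_eq_iter)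
open Summit.QuantumFields.YangMills.Theorems.K0Stub1DoubleBarFibreDictionary (emlIterU_gaugeActT_fine exists_fineGauge_pred_family)
open Summit.QuantumFields.YangMills.Theorems.K0Stub1DoubleBarFramesSU (suN_pred_inv)

variable {P : Params} {N : ℕ}

/-! ## §0  From equal `Q♭`-data to equal double-bar data -/

/-- **EQUAL `Q♭`-DATA ⇒ EQUAL DOUBLE-BAR DATA** at an index: `chartLogFlat η D A (j,c) = −i·log U̿^{(j)}(e^{iηA})(c)` (definitional), so for two fields whose double-bar bond variables at
`(j, c)` are within `1` of the identity (`exp ∘ log = id` there, ✓`MatrixLog.exp_mlog`), equal chart values give equal double-bar bond variables — the form in which the (49)♭-charted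
competitors (`Q♭(chart♭(A′)) = Q♭_lin A′`, constant along `A′₁ + tδ` for `δ` in print's kernel) deliver the `hidx` hypothesis of this file. [cite: Balaban1985Variational, (20) p.281, (44)-(49) p.285, (156) p.302; Balaban1985Averaging, (92) p.31] -/
theorem dbarIterU_eq_of_chartLogFlat_eq {𝔸 : Type*} [NormedRing 𝔸] [NormedAlgebra ℂ 𝔸] [CompleteSpace 𝔸] (η : ℝ) (D : Domains P) {A A₁ : PBond P 0 → 𝔸} (idx : BondIdx D)
    (hA : ‖((dbarIterU (idx.1.1 : ℕ) (expCfg η A) idx.1.2 : 𝔸ˣ) : 𝔸) - 1‖ < 1) (hA₁ : ‖((dbarIterU (idx.1.1 : ℕ) (expCfg η A₁) idx.1.2 : 𝔸ˣ) : 𝔸) - 1‖ < 1)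
    (h : chartLogFlat η D A idx = chartLogFlat η D A₁ idx) :
    dbarIterU (idx.1.1 : ℕ) (expCfg η A) idx.1.2 = dbarIterU (idx.1.1 : ℕ) (expCfg η A₁) idx.1.2 := by
  rw [chartLogFlat_apply, chartLogFlat_apply] at h
  have hI : (-Complex.I) ≠ 0 := neg_ne_zero.mpr Complex.I_ne_zero
  have hlog := smul_right_injective 𝔸 hI h
  apply Units.ext
  rw [← exp_mlog hA, ← exp_mlog hA₁]
  exact congrArg NormedSpace.exp hlog

/-! ## §1  Bookkeeping: the block-centre tower, the `SU(N)` predicate on the units of `M_N(ℂ)`, the units reading of a gauge copy -/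

/-- The block-centre tower of a fine gauge map is the map read at the iterated centres: `transfUp u j y = u (embIter j y)` (both recursions are the same).
[cite: Balaban1985Averaging, (11) p.19; Balaban1987RG1, (0.1) p.251] -/
theorem transfUp_eq_comp_embIter {G : Type*} (u : GaugeTransf P 0 G) : ∀ (j : ℕ) (y : Site P j), transfUp u j y = u (embIter j y)
  | 0, _ => rfl
  | j + 1, y => transfUp_eq_comp_embIter u j (emb y)

/-- `unitsField` intertwines the two gauge actions at every level (`B10Eq68TorusRegularity.unitsField_gaugeAct` is the level-`0` letter). [cite: Balaban1985Averaging, (8) p.19] -/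
theorem unitsField_gaugeAct_level [NeZero N] {j : ℕ} (u : GaugeTransf P j (Matrix.unitaryGroup (Fin N) ℂ)) (U : GaugeField P j (Matrix.unitaryGroup (Fin N) ℂ)) :
    unitsField (GaugeField.gaugeAct u U) = gaugeActT (fun x => Unitary.toUnits (u x)) (unitsField U) := by
  funext b
  apply Units.ext
  rw [val_unitsField, gaugeActT_apply]
  rfl

/-- The units reading of an `SU(N)` field determines it bondwise. [cite: Balaban1985Averaging, (19) p.21] -/
theorem eq_of_unitsField_toUField_eq {j : ℕ} {U U' : GaugeField P j (Matrix.specialUnitaryGroup (Fin N) ℂ)} {b : PBond P j}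
    (h : unitsField (toUField U) b = unitsField (toUField U') b) : U b = U' b := by
  have h1 := congrArg (fun u : (Matrix (Fin N) (Fin N) ℂ)ˣ => (u : Matrix (Fin N) (Fin N) ℂ)) h
  simp only [val_unitsField] at h1
  exact Subtype.ext h1

/-- «its matrix is an `SU(N)` matrix» — a multiplicative, inverse-closed predicate on the units of `M_N(ℂ)` containing `1` (the `p` fed to the fibre dictionary).
[cite: Balaban1985Averaging, (19) p.21] -/
theorem suPred_one : ∃ s : Matrix.specialUnitaryGroup (Fin N) ℂ, (s : Matrix (Fin N) (Fin N) ℂ) = ((1 : (Matrix (Fin N) (Fin N) ℂ)ˣ) : Matrix (Fin N) (Fin N) ℂ) :=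
  ⟨1, by rw [Units.val_one]; rfl⟩

/-- closure under products. [cite: Balaban1985Averaging, (19) p.21] -/
theorem suPred_mul (a b : (Matrix (Fin N) (Fin N) ℂ)ˣ)
    (ha : ∃ s : Matrix.specialUnitaryGroup (Fin N) ℂ, (s : Matrix (Fin N) (Fin N) ℂ) = (a : Matrix (Fin N) (Fin N) ℂ))
    (hb : ∃ s : Matrix.specialUnitaryGroup (Fin N) ℂ, (s : Matrix (Fin N) (Fin N) ℂ) = (b : Matrix (Fin N) (Fin N) ℂ)) :
    ∃ s : Matrix.specialUnitaryGroup (Fin N) ℂ, (s : Matrix (Fin N) (Fin N) ℂ) = ((a * b : (Matrix (Fin N) (Fin N) ℂ)ˣ) : Matrix (Fin N) (Fin N) ℂ) := by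
  obtain ⟨s, hs⟩ := ha
  obtain ⟨t, ht⟩ := hb
  exact ⟨s * t, by rw [Units.val_mul, ← hs, ← ht]; rfl⟩

/-! ## §2  The record edition: an `SU(N)` gauge copy of the competitor lies in NODE 00's multi-level (0.4) fibre -/

section Record

variable [NeZero N] (k : ℕ) (D : Domains P) (hDk : D.k = k)
  (hcollar : ∀ (i : ℕ) (e : PBond P (i + 1)), D.LamBond (i + 1) e → ∀ z : Site P i, (blockOf z = e.src ∨ blockOf z = e.tgt) → z ∈ D.Om i)

include hDk hcollar in
/-- ★★★ **THE ♭ → (0.4) FIBRE DICTIONARY AT THE K0 CARRIER, FAMILY FORM.**  `D` nested (`D.k = k`, collar), level weights `w`, radius `R` with the dictionary budgets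
`12800ℓ²LR ≤ 1`, `60ℓ²LR < δ_N` (n07-w2 `coe_emlIterU_expCfg_eq_iter`); `A₁` and every `A t` (`t : ι`) in the weighted ball `w₁(b)‖·‖ < R`, read by `SU(N)` fields `U₁`, `U t` with
`U(b) = e^{iηA(b)}` (`η = L^{−k}`); EQUAL DOUBLE-BAR DATA `U̿^{(j)}(e^{iηA t})(c) = U̿^{(j)}(e^{iηA₁})(c)` on the [B6] (2.3) index bonds; and the block frames of all these towers in `SU(N)` on an
`emb`-closed family of small-readable blocks `Sm ⊇ Ω` (displayed: `hvf₁`, `hvf`).  THEN there is ONE family of `SU(N)` GAUGE TRANSFORMATIONS `h t : T_η → SU(N)` with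
(i) the uniform-choice clause (every `h t x` is `1` for all `t`, or the frame quotient `V₁_j(y)·(V t)_j(y)⁻¹` at ONE touched `(j, y)` over `x` for all `t`) and
(ii) `Ū^{(j)}_{(0.4)}((U t)^{h t})(c) = Ū^{(j)}_{(0.4)}(U₁)(c)` — THE RECORD's GUARDED `SU(N)` AVERAGES (`Node00.avOfRecord = blockAvg expMeanLogSU`) — at EVERY index bond of EVERY level
`j ≤ k`: each charted competitor has an `SU(N)` gauge copy IN NODE 00's multi-level fibre `{U | Ū^j(U) = Ū^j(U₁) on Λ_j ∀ j}` through `U₁`.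
[cite: Balaban1985Averaging, (11) p.19, (92) p.31, (97)-(100) p.32, (110) p.34; Balaban1984PropagatorsII, (2.1)-(2.4) p.224; Balaban1985Variational, (5)-(6) p.278, (152) p.301, (156) p.302; Balaban1987RG1, (0.4) p.253, (0.11) p.253] -/
theorem exists_suGauge_family_iter_eq {w : ℕ → PBond P 0 → ℝ} (hw : IsLevWeight P k D w) {R : ℝ}
    (hR : 12800 * (((P.d + 2) * P.L : ℕ) : ℝ) ^ 2 * (P.L : ℝ) * R ≤ 1) (hguard : 60 * (((P.d + 2) * P.L : ℕ) : ℝ) ^ 2 * (P.L : ℝ) * R < deltaSU (Fin N))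
    {ι : Type*} {A₁ : PBond P 0 → Matrix (Fin N) (Fin N) ℂ} {A : ι → PBond P 0 → Matrix (Fin N) (Fin N) ℂ}
    (hA₁ : ∀ b, w 1 b * ‖A₁ b‖ < R) (hA : ∀ t b, w 1 b * ‖A t b‖ < R)
    (U₁ : GaugeField P 0 (Matrix.specialUnitaryGroup (Fin N) ℂ)) (U : ι → GaugeField P 0 (Matrix.specialUnitaryGroup (Fin N) ℂ))
    (hU₁ : ∀ b, ((U₁ b : Matrix.specialUnitaryGroup (Fin N) ℂ) : Matrix (Fin N) (Fin N) ℂ) = ((expCfg (((P.L : ℝ)⁻¹) ^ k) A₁ b : (Matrix (Fin N) (Fin N) ℂ)ˣ) : _))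
    (hU : ∀ t b, ((U t b : Matrix.specialUnitaryGroup (Fin N) ℂ) : Matrix (Fin N) (Fin N) ℂ) = ((expCfg (((P.L : ℝ)⁻¹) ^ k) (A t) b : (Matrix (Fin N) (Fin N) ℂ)ˣ) : _))
    (hidx : ∀ (t : ι) (idx : BondIdx D),
      dbarIterU (idx.1.1 : ℕ) (expCfg (((P.L : ℝ)⁻¹) ^ k) (A t)) idx.1.2 = dbarIterU (idx.1.1 : ℕ) (expCfg (((P.L : ℝ)⁻¹) ^ k) A₁) idx.1.2)
    (V : ι → (j : ℕ) → Site P j → (Matrix (Fin N) (Fin N) ℂ)ˣ) (hV0 : ∀ t x, V t 0 x = 1)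
    (hVs : ∀ (t : ι) (j : ℕ) (y : Site P (j + 1)), V t (j + 1) y = V t j (emb y) * vframeU (dbarIterU j (expCfg (((P.L : ℝ)⁻¹) ^ k) (A t))) y)
    (V₁ : (j : ℕ) → Site P j → (Matrix (Fin N) (Fin N) ℂ)ˣ) (hV₁0 : ∀ x, V₁ 0 x = 1)
    (hV₁s : ∀ (j : ℕ) (y : Site P (j + 1)), V₁ (j + 1) y = V₁ j (emb y) * vframeU (dbarIterU j (expCfg (((P.L : ℝ)⁻¹) ^ k) A₁)) y)
    (Sm : (j : ℕ) → Set (Site P j)) (hemb : ∀ (j : ℕ) (z : Site P (j + 1)), z ∈ Sm (j + 1) → emb z ∈ Sm j)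
    (hΩ : ∀ (j : ℕ) (y : Site P (j + 1)), j + 1 ≤ D.k → y ∈ D.Om (j + 1) → y ∈ Sm (j + 1))
    (hvf₁ : ∀ (j : ℕ) (z : Site P (j + 1)), z ∈ Sm (j + 1) →
      ∃ s : Matrix.specialUnitaryGroup (Fin N) ℂ, (s : Matrix (Fin N) (Fin N) ℂ) = ((vframeU (dbarIterU j (expCfg (((P.L : ℝ)⁻¹) ^ k) A₁)) z : (Matrix (Fin N) (Fin N) ℂ)ˣ) : _))
    (hvf : ∀ (t : ι) (j : ℕ) (z : Site P (j + 1)), z ∈ Sm (j + 1) →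
      ∃ s : Matrix.specialUnitaryGroup (Fin N) ℂ, (s : Matrix (Fin N) (Fin N) ℂ) = ((vframeU (dbarIterU j (expCfg (((P.L : ℝ)⁻¹) ^ k) (A t))) z : (Matrix (Fin N) (Fin N) ℂ)ˣ) : _)) :
    ∃ h : ι → GaugeTransf P 0 (Matrix.specialUnitaryGroup (Fin N) ℂ),
      (∀ x : Site P 0, (∀ t, ((h t x : Matrix.specialUnitaryGroup (Fin N) ℂ) : Matrix (Fin N) (Fin N) ℂ) = 1) ∨
        ∃ (j : ℕ) (c : PBond P j) (y : Site P j), j ≤ D.k ∧ D.LamBond j c ∧ (y = c.src ∨ y = c.tgt) ∧ embIter j y = x ∧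
          ∀ t, ((h t x : Matrix.specialUnitaryGroup (Fin N) ℂ) : Matrix (Fin N) (Fin N) ℂ) = ((V₁ j y * (V t j y)⁻¹ : (Matrix (Fin N) (Fin N) ℂ)ˣ) : _)) ∧
      ∀ (t : ι) (j : ℕ) (c : PBond P j), j ≤ k → D.LamBond j c →
        Averaging.iter (fun _ => blockAvg expMeanLogSU) j (GaugeField.gaugeAct (h t) (U t)) c = Averaging.iter (fun _ => blockAvg expMeanLogSU) j U₁ c := by
  -- the fine gauge maps of the dictionary, with values whose matrices are in `SU(N)`
  obtain ⟨g, hp, hch, hg⟩ := exists_fineGauge_pred_family D hcollar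
    (fun u : (Matrix (Fin N) (Fin N) ℂ)ˣ => ∃ s : Matrix.specialUnitaryGroup (Fin N) ℂ, (s : Matrix (Fin N) (Fin N) ℂ) = (u : Matrix (Fin N) (Fin N) ℂ))
    suPred_one suPred_mul (fun u hu => suN_pred_inv u hu) (expCfg (((P.L : ℝ)⁻¹) ^ k) A₁) (fun t => expCfg (((P.L : ℝ)⁻¹) ^ k) (A t)) hidx V hV0 hVs V₁ hV₁0 hV₁s Sm hemb hΩ hvf₁ hvf
  -- their `SU(N)` lifts
  choose h hh using hp
  refine ⟨h, fun x => ?_, fun t j c hj hc => ?_⟩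
  · rcases hch x with h1 | ⟨j, c, y, hj, hc, hy, hx, hval⟩
    · exact Or.inl fun t => by rw [hh t x, h1 t, Units.val_one]
    · exact Or.inr ⟨j, c, y, hj, hc, hy, hx, fun t => by rw [hh t x, hval t]⟩
  · have hjk : j ≤ D.k := hDk ▸ hj
    have hjP : j ≤ P.m + P.K := hjk.trans D.hk
    set idx : BondIdx D := ⟨⟨⟨j, Nat.lt_succ_of_le hjk⟩, c⟩, hc⟩
    -- the two dictionaries at the index bond
    have hdU := (coe_emlIterU_expCfg_eq_iter k D hDk hcollar hw hR hguard (hA t) (U t) (hU t) idx).1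
    have hdU₁ := (coe_emlIterU_expCfg_eq_iter k D hDk hcollar hw hR hguard hA₁ U₁ hU₁ idx).1
    -- the fibre dictionary at the index bond
    have hfib := hg t j c hjk hc
    apply eq_of_unitsField_toUField_eq
    rw [iter_gaugeAct _ (h t) j hjP (U t), toUField_gaugeAct, unitsField_gaugeAct_level, gaugeActT_apply]
    change _ = unitsField (toUField (Averaging.iter (fun _ => blockAvg expMeanLogSU) (idx.1.1 : ℕ) U₁)) idx.1.2
    rw [← hdU₁]
    change _ * unitsField (toUField (Averaging.iter (fun _ => blockAvg expMeanLogSU) (idx.1.1 : ℕ) (U t))) idx.1.2 * _ = _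
    rw [← hdU]
    change _ * emlIterU j (expCfg (((P.L : ℝ)⁻¹) ^ k) (A t)) c * _ = emlIterU j (expCfg (((P.L : ℝ)⁻¹) ^ k) A₁) c
    rw [← hfib, emlIterU_gaugeActT_fine, gaugeActT_apply, transfUp_eq_comp_embIter, transfUp_eq_comp_embIter]
    have hunit : ∀ x : Site P 0, Unitary.toUnits (suIncl (h t x)) = g t x := fun x => by
      apply Units.ext
      rw [← hh t x]
      rfl
    rw [hunit, hunit]

include hDk hcollar in
/-- ★★★ **THE ♭ → (0.4) FIBRE DICTIONARY AT THE K0 CARRIER** (one competitor): equal double-bar data on the index bonds + the dictionary budgets + block frames in `SU(N)` on the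
small-readable blocks ⇒ `∃ h : T_η → SU(N)` with `Ū^{(j)}_{(0.4)}(U^{h})(c) = Ū^{(j)}_{(0.4)}(U₁)(c)` at every index bond of every level `j ≤ k`.
[cite: Balaban1985Averaging, (11) p.19, (92) p.31, (97)-(100) p.32, (110) p.34; Balaban1984PropagatorsII, (2.1)-(2.4) p.224; Balaban1985Variational, (5)-(6) p.278, (152) p.301, (156) p.302; Balaban1987RG1, (0.4) p.253, (0.11) p.253] -/
theorem exists_suGauge_iter_eq {w : ℕ → PBond P 0 → ℝ} (hw : IsLevWeight P k D w) {R : ℝ}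
    (hR : 12800 * (((P.d + 2) * P.L : ℕ) : ℝ) ^ 2 * (P.L : ℝ) * R ≤ 1) (hguard : 60 * (((P.d + 2) * P.L : ℕ) : ℝ) ^ 2 * (P.L : ℝ) * R < deltaSU (Fin N))
    {A₁ A : PBond P 0 → Matrix (Fin N) (Fin N) ℂ} (hA₁ : ∀ b, w 1 b * ‖A₁ b‖ < R) (hA : ∀ b, w 1 b * ‖A b‖ < R)
    (U₁ U : GaugeField P 0 (Matrix.specialUnitaryGroup (Fin N) ℂ))
    (hU₁ : ∀ b, ((U₁ b : Matrix.specialUnitaryGroup (Fin N) ℂ) : Matrix (Fin N) (Fin N) ℂ) = ((expCfg (((P.L : ℝ)⁻¹) ^ k) A₁ b : (Matrix (Fin N) (Fin N) ℂ)ˣ) : _))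
    (hU : ∀ b, ((U b : Matrix.specialUnitaryGroup (Fin N) ℂ) : Matrix (Fin N) (Fin N) ℂ) = ((expCfg (((P.L : ℝ)⁻¹) ^ k) A b : (Matrix (Fin N) (Fin N) ℂ)ˣ) : _))
    (hidx : ∀ idx : BondIdx D, dbarIterU (idx.1.1 : ℕ) (expCfg (((P.L : ℝ)⁻¹) ^ k) A) idx.1.2 = dbarIterU (idx.1.1 : ℕ) (expCfg (((P.L : ℝ)⁻¹) ^ k) A₁) idx.1.2)
    (Sm : (j : ℕ) → Set (Site P j)) (hemb : ∀ (j : ℕ) (z : Site P (j + 1)), z ∈ Sm (j + 1) → emb z ∈ Sm j)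
    (hΩ : ∀ (j : ℕ) (y : Site P (j + 1)), j + 1 ≤ D.k → y ∈ D.Om (j + 1) → y ∈ Sm (j + 1))
    (hvf₁ : ∀ (j : ℕ) (z : Site P (j + 1)), z ∈ Sm (j + 1) →
      ∃ s : Matrix.specialUnitaryGroup (Fin N) ℂ, (s : Matrix (Fin N) (Fin N) ℂ) = ((vframeU (dbarIterU j (expCfg (((P.L : ℝ)⁻¹) ^ k) A₁)) z : (Matrix (Fin N) (Fin N) ℂ)ˣ) : _))
    (hvf : ∀ (j : ℕ) (z : Site P (j + 1)), z ∈ Sm (j + 1) →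
      ∃ s : Matrix.specialUnitaryGroup (Fin N) ℂ, (s : Matrix (Fin N) (Fin N) ℂ) = ((vframeU (dbarIterU j (expCfg (((P.L : ℝ)⁻¹) ^ k) A)) z : (Matrix (Fin N) (Fin N) ℂ)ˣ) : _)) :
    ∃ h : GaugeTransf P 0 (Matrix.specialUnitaryGroup (Fin N) ℂ), ∀ (j : ℕ) (c : PBond P j), j ≤ k → D.LamBond j c →
      Averaging.iter (fun _ => blockAvg expMeanLogSU) j (GaugeField.gaugeAct h U) c = Averaging.iter (fun _ => blockAvg expMeanLogSU) j U₁ c := by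
  obtain ⟨V, hV0, hVs, -⟩ := exists_accFrames_dbarIterU (P := P) (expCfg (((P.L : ℝ)⁻¹) ^ k) A)
  obtain ⟨V₁, hV₁0, hV₁s, -⟩ := exists_accFrames_dbarIterU (P := P) (expCfg (((P.L : ℝ)⁻¹) ^ k) A₁)
  obtain ⟨h, -, hh⟩ := exists_suGauge_family_iter_eq k D hDk hcollar hw hR hguard (A := fun _ : Unit => A) hA₁ (fun _ => hA) U₁ (fun _ => U) hU₁ (fun _ => hU)
    (fun _ => hidx) (fun _ => V) (fun _ => hV0) (fun _ => hVs) V₁ hV₁0 hV₁s Sm hemb hΩ hvf₁ (fun _ => hvf)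
  exact ⟨h (), hh ()⟩

end Record

/-! ## §3  At NODE 00's record objects: the averaging of record `avOfRecord` and the multi-scale field `avgFamily` -/

section T4

open T4Continuum (T4Family)

variable (F : T4Family) (N : ℕ) [NeZero N] (K k : ℕ) (D : Domains (F.P K)) (hDk : D.k = k)
  (hcollar : ∀ (i : ℕ) (e : PBond (F.P K) (i + 1)), D.LamBond (i + 1) e → ∀ z : Site (F.P K) i, (blockOf z = e.src ∨ blockOf z = e.tgt) → z ∈ D.Om i)

include hDk hcollar in
/-- ★★★ **NODE 00 EDITION, FAMILY FORM**: the conclusion of `exists_suGauge_family_iter_eq` in the letters of `Node00.IsCritOnFibre` ∕ `B15.AgreeOn` — the multi-scale fields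
`avgFamily (avOfRecord F N K)` of the `SU(N)` gauge copies `(U t)^{h t}` and of `U₁` AGREE on every [B6] (2.3) index bond of every level `j ≤ k` (`avOfRecord F N K j = blockAvg expMeanLogSU`
by `rfl`).  With `U₁` the record's charted minimiser and `U t = e^{iη·chart♭(A′₁ + tδ)}`: the curve `t ↦ (U t)^{h t}` runs INSIDE the fibre on which the record is critical, through
`U₁` whenever `h 0 = 1`-valued (uniform-choice clause with `V 0 = V₁`). [cite: Balaban1985Variational, (5)-(6) p.278, (156) p.302; Balaban1988Convergent, (2.10)-(2.12) p.256; Balaban1985Averaging, (92) p.31, (97)-(100) p.32] -/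
theorem exists_suGauge_family_avgFamily_eq {w : ℕ → PBond (F.P K) 0 → ℝ} (hw : IsLevWeight (F.P K) k D w) {R : ℝ}
    (hR : 12800 * ((((F.P K).d + 2) * (F.P K).L : ℕ) : ℝ) ^ 2 * ((F.P K).L : ℝ) * R ≤ 1)
    (hguard : 60 * ((((F.P K).d + 2) * (F.P K).L : ℕ) : ℝ) ^ 2 * ((F.P K).L : ℝ) * R < deltaSU (Fin N))
    {ι : Type*} {A₁ : PBond (F.P K) 0 → Matrix (Fin N) (Fin N) ℂ} {A : ι → PBond (F.P K) 0 → Matrix (Fin N) (Fin N) ℂ}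
    (hA₁ : ∀ b, w 1 b * ‖A₁ b‖ < R) (hA : ∀ t b, w 1 b * ‖A t b‖ < R)
    (U₁ : GaugeField (F.P K) 0 (Matrix.specialUnitaryGroup (Fin N) ℂ)) (U : ι → GaugeField (F.P K) 0 (Matrix.specialUnitaryGroup (Fin N) ℂ))
    (hU₁ : ∀ b, ((U₁ b : Matrix.specialUnitaryGroup (Fin N) ℂ) : Matrix (Fin N) (Fin N) ℂ) = ((expCfg ((((F.P K).L : ℝ)⁻¹) ^ k) A₁ b : (Matrix (Fin N) (Fin N) ℂ)ˣ) : _))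
    (hU : ∀ t b, ((U t b : Matrix.specialUnitaryGroup (Fin N) ℂ) : Matrix (Fin N) (Fin N) ℂ) = ((expCfg ((((F.P K).L : ℝ)⁻¹) ^ k) (A t) b : (Matrix (Fin N) (Fin N) ℂ)ˣ) : _))
    (hidx : ∀ (t : ι) (idx : BondIdx D),
      dbarIterU (idx.1.1 : ℕ) (expCfg ((((F.P K).L : ℝ)⁻¹) ^ k) (A t)) idx.1.2 = dbarIterU (idx.1.1 : ℕ) (expCfg ((((F.P K).L : ℝ)⁻¹) ^ k) A₁) idx.1.2)
    (V : ι → (j : ℕ) → Site (F.P K) j → (Matrix (Fin N) (Fin N) ℂ)ˣ) (hV0 : ∀ t x, V t 0 x = 1)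
    (hVs : ∀ (t : ι) (j : ℕ) (y : Site (F.P K) (j + 1)), V t (j + 1) y = V t j (emb y) * vframeU (dbarIterU j (expCfg ((((F.P K).L : ℝ)⁻¹) ^ k) (A t))) y)
    (V₁ : (j : ℕ) → Site (F.P K) j → (Matrix (Fin N) (Fin N) ℂ)ˣ) (hV₁0 : ∀ x, V₁ 0 x = 1)
    (hV₁s : ∀ (j : ℕ) (y : Site (F.P K) (j + 1)), V₁ (j + 1) y = V₁ j (emb y) * vframeU (dbarIterU j (expCfg ((((F.P K).L : ℝ)⁻¹) ^ k) A₁)) y)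
    (Sm : (j : ℕ) → Set (Site (F.P K) j)) (hemb : ∀ (j : ℕ) (z : Site (F.P K) (j + 1)), z ∈ Sm (j + 1) → emb z ∈ Sm j)
    (hΩ : ∀ (j : ℕ) (y : Site (F.P K) (j + 1)), j + 1 ≤ D.k → y ∈ D.Om (j + 1) → y ∈ Sm (j + 1))
    (hvf₁ : ∀ (j : ℕ) (z : Site (F.P K) (j + 1)), z ∈ Sm (j + 1) →
      ∃ s : Matrix.specialUnitaryGroup (Fin N) ℂ, (s : Matrix (Fin N) (Fin N) ℂ) = ((vframeU (dbarIterU j (expCfg ((((F.P K).L : ℝ)⁻¹) ^ k) A₁)) z : (Matrix (Fin N) (Fin N) ℂ)ˣ) : _))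
    (hvf : ∀ (t : ι) (j : ℕ) (z : Site (F.P K) (j + 1)), z ∈ Sm (j + 1) →
      ∃ s : Matrix.specialUnitaryGroup (Fin N) ℂ, (s : Matrix (Fin N) (Fin N) ℂ) = ((vframeU (dbarIterU j (expCfg ((((F.P K).L : ℝ)⁻¹) ^ k) (A t))) z : (Matrix (Fin N) (Fin N) ℂ)ˣ) : _)) :
    ∃ h : ι → GaugeTransf (F.P K) 0 (Matrix.specialUnitaryGroup (Fin N) ℂ),
      (∀ x : Site (F.P K) 0, (∀ t, ((h t x : Matrix.specialUnitaryGroup (Fin N) ℂ) : Matrix (Fin N) (Fin N) ℂ) = 1) ∨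
        ∃ (j : ℕ) (c : PBond (F.P K) j) (y : Site (F.P K) j), j ≤ D.k ∧ D.LamBond j c ∧ (y = c.src ∨ y = c.tgt) ∧ embIter j y = x ∧
          ∀ t, ((h t x : Matrix.specialUnitaryGroup (Fin N) ℂ) : Matrix (Fin N) (Fin N) ℂ) = ((V₁ j y * (V t j y)⁻¹ : (Matrix (Fin N) (Fin N) ℂ)ˣ) : _)) ∧
      ∀ (t : ι) (j : ℕ) (c : PBond (F.P K) j), j ≤ k → D.LamBond j c →
        avgFamily (avOfRecord F N K) (GaugeField.gaugeAct (h t) (U t)) j c = avgFamily (avOfRecord F N K) U₁ j c :=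
  exists_suGauge_family_iter_eq k D hDk hcollar hw hR hguard hA₁ hA U₁ U hU₁ hU hidx V hV0 hVs V₁ hV₁0 hV₁s Sm hemb hΩ hvf₁ hvf

end T4


end Summit.QuantumFields.YangMills.Theorems.K0Stub1DoubleBarFibreAtRecord

end
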